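import Literature.Geometry.Symplectic.SymplecticEnergyIdentity
import Literature.Geometry.Symplectic.TaubesFamilyLTwoBounds
import Literature.Geometry.Symplectic.TaubesFamilyCurvatureIntegral
import Literature.Geometry.GaugeTheory.ConnectionDifference
import Literature.Geometry.GaugeTheory.SeibergWittenGaugeInvariance
import HarnessLib

/-!
# Hutchings–Taubes (4.18) for the family `(SW_r)`: the `∂̄`- and `∂`-energies of `α`

Topic `Literature/Geometry/Symplectic`; Step 3 of the proof of `SW(K⁻¹) = ±1` in Hutchings–Taubes
(1999), §4.5 (`= Taubes 1995, §5 Step 3, (5.5)`), specialised to the tree's family.  For a solution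
`(A, ψ)` of the Seiberg–Witten equations of `𝔰_J` with perturbation `P₊F_{A₀} - (r/4)s`, `r = |c|²`,
write `α = ψ_{u₀}` for the `u₀`-component of `ψ` — a global smooth complex function on `N`
(`alphaFun`, `contMDiff_alphaFun`; the transition functions of `𝔰_J` fix `u₀`) — and
`a = ½(A - A₀)` for the real 1-form by which the determinant connection differs from Taubes's
(`halfConnectionDiff`; `∇' = d + ia` is the connection `A` induces on the trivial summand).  Then,
with `∇'_k = ∇'_{e_k}` in the unitary frame of `𝔰_J` at each point:

  `∫_N ((|∇'₀α+i∇'₁α|² + |∇'₂α+i∇'₃α|²) - (|∇'₀α-i∇'₁α|² + |∇'₂α-i∇'₃α|²)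
        - ½|α|²(|α|² - |β|² - r))(s ∧ s) = 0`

(`integral_dbar_sub_del_alpha_eq_zero`): the energy identity `SymplecticEnergyIdentity` for `(α, a)`
with the curvature `da(e₀,e₁) + da(e₂,e₃) = ½((F_A - F_{A₀})(e₀,e₁) + (F_A - F_{A₀})(e₂,e₃))
= ¼(|α|² - |β|² - r)` of the family (`curvatureForm_sub_frame_sum_eq`) inserted — Hutchings–Taubes's
`∫|∇_aα|² = ∫ 2|∂̄_aα|² + ∫ r(1 - |α|² + |β|²)|α|²` in the tree's scaling `ψ = αu₀ + β`
(`|ψ₁|² = |α|²`, `|ψ₀|² = |β|²`, no `√r`).  Equivalently (`|p+iq|² + |p-iq|² = 2(|p|²+|q|²)`):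
`∫ (Σ_k|∇'_kα|² - (|∇'₀α+i∇'₁α|² + |∇'₂α+i∇'₃α|²) + ¼|α|²(|α|² - |β|² - r))(s ∧ s) = 0`
(`integral_grad_alpha_energy_eq_zero`; `|∂̄'α|²` here is the full `|∇'₀α+i∇'₁α|² + |∇'₂α+i∇'₃α|²`).

PROVED, 0 named facts.

## References

* M. Hutchings, C. H. Taubes, *An introduction to the Seiberg–Witten equations on symplectic
  manifolds*, IAS/Park City Math. Ser. 7 (1999; AMS 2006), §4.5 (4.13), (4.18). [HutchingsTaubes2006]
* C. H. Taubes, *The Seiberg–Witten and Gromov invariants*, Math. Res. Lett. 2 (1995) 221–238,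
  §5 Step 3 (5.5). [Taubes1995]
-/

noncomputable section

open scoped Manifold ContDiff Topology ComplexConjugate
open Set Function Filter Complex Literature.Geometry.Kaehler Literature.Geometry.GaugeTheory Literature.Topology.FourManifolds
open Literature.Geometry.Lorentzian (PseudoRiemannianMetric)
open Literature.Geometry.Manifold Literature.Geometry.Manifold.DeRhamSignFour Literature.NumberTheory.Transcendental

namespace Literature.Geometry.Symplectic

namespace AlmostComplexStructure.IsCompatibleWith

variable {N : Type} [TopologicalSpace N] [ChartedSpace (EuclideanSpace ℝ (Fin 4)) N] [IsManifold (𝓡 4) ∞ N]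
  {J : AlmostComplexStructure (𝓡 4) ∞ N} {s : MForm (𝓡 4) N ℝ 2}
  (h : J.IsCompatibleWith s) (hs : IsSmoothForm s)
  (hnd : ∀ x (v : TangentSpace (𝓡 4) x), v ≠ 0 → ∃ w : TangentSpace (𝓡 4) x, s x ![v, w] ≠ 0)

/-! ### The function `α = ψ_{u₀}` and the 1-form `a = ½(A - A₀)` -/

/-- **`α = ψ_{u₀}`**, the `u₀`-component of the spinor of a configuration of `𝔰_J`, read in the chart
at each point: a global complex function (the transition functions of `𝔰_J` fix `u₀`, `alphaFun_eq`).
[cite: Taubes1995, §5 (5.3)] -/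
def alphaFun (cfg : (h.canonicalSpincStructure hs hnd).Configuration) (x : N) : ℂ :=
  cfg.plusSpinor ((h.canonicalSpincStructure hs hnd).indexAt x) x 1

/-- `α` may be read in any chart containing the point. [cite: Taubes1994, §1 (p. 811)] -/
theorem alphaFun_eq (cfg : (h.canonicalSpincStructure hs hnd).Configuration) (i : N) {x : N}
    (hx : x ∈ (h.canonicalSpincStructure hs hnd).baseSet i) :
    h.alphaFun hs hnd cfg x = cfg.plusSpinor i x 1 := by
  unfold alphaFun SpincStructure.Configuration.plusSpinor
  rw [(h.unitaryAdaptedFrames hs hnd).toFun_inl_one_eq cfg.spinor ⟨hx, (h.canonicalSpincStructure hs hnd).mem_baseSet_indexAt x⟩]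

/-- `|α|² = alphaSq`. [folklore] -/
theorem normSq_alphaFun (cfg : (h.canonicalSpincStructure hs hnd).Configuration) (x : N) :
    Complex.normSq (h.alphaFun hs hnd cfg x) = h.alphaSq hs hnd cfg x :=
  rfl

/-- **`α` is smooth.** [folklore] -/
theorem contMDiff_alphaFun (cfg : (h.canonicalSpincStructure hs hnd).Configuration) :
    ContMDiff (𝓡 4) 𝓘(ℝ, ℂ) ∞ (h.alphaFun hs hnd cfg) := by
  intro x₀
  have hi := (h.canonicalSpincStructure hs hnd).mem_baseSet_indexAt x₀
  have hev : h.alphaFun hs hnd cfg =ᶠ[𝓝 x₀]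
      fun x ↦ cfg.spinor.toFun ((h.canonicalSpincStructure hs hnd).indexAt x₀) x (Sum.inl 1) := by
    filter_upwards [((h.canonicalSpincStructure hs hnd).isOpen_baseSet _).mem_nhds hi] with x hx
    rw [h.alphaFun_eq hs hnd cfg _ hx]
    rfl
  refine ContMDiffAt.congr_of_eventuallyEq ?_ hev
  exact (cfg.isSmooth _ (Sum.inl 1)).contMDiffAt (((h.canonicalSpincStructure hs hnd).isOpen_baseSet _).mem_nhds hi)

/-- **`a = ½(A - A₀)`**: half the difference of the determinant connection of a configuration and
Taubes's connection — the real 1-form with `∇^A = ∇^{A₀} + ia` on `det = K⁻¹` squared roots, i.e. the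
connection `A` induces on the trivial summand of `S⁺ = ε ⊕ K⁻¹`. [cite: HutchingsTaubes2006, §4.3] -/
def halfConnectionDiff [(h.metric hs).HasLeviCivita] (cfg : (h.canonicalSpincStructure hs hnd).Configuration) : RealOneForm N :=
  (2⁻¹ : ℝ) • (h.canonicalSpincStructure hs hnd).connectionDiff cfg.conn (h.taubesConnection hs hnd)

/-- `a` is smooth. [folklore] -/
theorem smoothAt_halfConnectionDiff [(h.metric hs).HasLeviCivita] (cfg : (h.canonicalSpincStructure hs hnd).Configuration)
    (x : N) : (h.halfConnectionDiff hs hnd cfg).SmoothAt x :=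
  ((h.canonicalSpincStructure hs hnd).smoothAt_connectionDiff _ _ x).smul _

/-- **`da(e₀,e₁) + da(e₂,e₃) = ¼(|α|² - |β|² - r)` for a solution of the family**
(`2da = F_A - F_{A₀}` and the `ω`-component of the curvature equation). [cite: HutchingsTaubes2006, §4.4 (4.13)] -/
theorem mextDeriv_halfConnectionDiff_frame_sum [(h.metric hs).HasLeviCivita] (c : ℂ)
    {cfg : (h.canonicalSpincStructure hs hnd).Configuration}
    (hsol : SpincStructure.IsSolution (h.taubesPerturbation hs hnd - h.symplecticPerturbation hs hnd (Complex.normSq c / 4)) cfg)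
    (x : N) :
    mextDeriv (h.halfConnectionDiff hs hnd cfg).toMForm x
        ![(h.canonicalSpincStructure hs hnd).frame ((h.canonicalSpincStructure hs hnd).indexAt x) 0 x,
          (h.canonicalSpincStructure hs hnd).frame ((h.canonicalSpincStructure hs hnd).indexAt x) 1 x] +
      mextDeriv (h.halfConnectionDiff hs hnd cfg).toMForm x
        ![(h.canonicalSpincStructure hs hnd).frame ((h.canonicalSpincStructure hs hnd).indexAt x) 2 x,
          (h.canonicalSpincStructure hs hnd).frame ((h.canonicalSpincStructure hs hnd).indexAt x) 3 x] =
      (h.alphaSq hs hnd cfg x - h.betaSq hs hnd cfg x - Complex.normSq c) / 4 := by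
  have hF := h.curvatureForm_sub_frame_sum_eq hs hnd c hsol x
  rw [(h.canonicalSpincStructure hs hnd).curvatureForm_sub_eq_mextDeriv] at hF
  have h2 : mextDeriv (h.halfConnectionDiff hs hnd cfg).toMForm =
      (2⁻¹ : ℝ) • mextDeriv ((h.canonicalSpincStructure hs hnd).connectionDiff cfg.conn (h.taubesConnection hs hnd)).toMForm := by
    rw [halfConnectionDiff, RealOneForm.toMForm_smul, Literature.Geometry.Kaehler.mextDeriv_smul]
  rw [h2]
  simp only [Pi.smul_apply, ContinuousAlternatingMap.smul_apply, smul_eq_mul]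
  unfold alphaSq betaSq
  linarith

/-! ### The energy identities -/

/-- **Hutchings–Taubes (4.18) for the family, `∂̄`/`∂` form**: for a solution `(A, ψ)` of `(SW)` with
perturbation `P₊F_{A₀} - (r/4)s`, `α = ψ_{u₀}`, `∇' = d + ia`, `a = ½(A - A₀)`,
`∫_N ((|∇'₀α+i∇'₁α|² + |∇'₂α+i∇'₃α|²) - (|∇'₀α-i∇'₁α|² + |∇'₂α-i∇'₃α|²) - ½|α|²(|α|² - |β|² - r))(s ∧ s) = 0`.
[cite: HutchingsTaubes2006, §4.5 (4.18)] [cite: Taubes1995, §5 Step 3 (5.5)] -/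
theorem integral_dbar_sub_del_alpha_eq_zero [T2Space N] [CompactSpace N] [(h.metric hs).HasLeviCivita]
    (hcl : IsClosedForm s) (c : ℂ) {cfg : (h.canonicalSpincStructure hs hnd).Configuration}
    (hsol : SpincStructure.IsSolution (h.taubesPerturbation hs hnd - h.symplecticPerturbation hs hnd (Complex.normSq c / 4)) cfg) :
    MForm.integral (rayFamily (wedge_self_castDeg_apply_ne_zero s hnd))
      ((fun x ↦
          (Complex.normSq (connDeriv (h.alphaFun hs hnd cfg) (h.halfConnectionDiff hs hnd cfg) x
                ((h.canonicalSpincStructure hs hnd).frame ((h.canonicalSpincStructure hs hnd).indexAt x) 0 x) +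
              I * connDeriv (h.alphaFun hs hnd cfg) (h.halfConnectionDiff hs hnd cfg) x
                ((h.canonicalSpincStructure hs hnd).frame ((h.canonicalSpincStructure hs hnd).indexAt x) 1 x)) +
            Complex.normSq (connDeriv (h.alphaFun hs hnd cfg) (h.halfConnectionDiff hs hnd cfg) x
                ((h.canonicalSpincStructure hs hnd).frame ((h.canonicalSpincStructure hs hnd).indexAt x) 2 x) +
              I * connDeriv (h.alphaFun hs hnd cfg) (h.halfConnectionDiff hs hnd cfg) x
                ((h.canonicalSpincStructure hs hnd).frame ((h.canonicalSpincStructure hs hnd).indexAt x) 3 x))) -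
          (Complex.normSq (connDeriv (h.alphaFun hs hnd cfg) (h.halfConnectionDiff hs hnd cfg) x
                ((h.canonicalSpincStructure hs hnd).frame ((h.canonicalSpincStructure hs hnd).indexAt x) 0 x) -
              I * connDeriv (h.alphaFun hs hnd cfg) (h.halfConnectionDiff hs hnd cfg) x
                ((h.canonicalSpincStructure hs hnd).frame ((h.canonicalSpincStructure hs hnd).indexAt x) 1 x)) +
            Complex.normSq (connDeriv (h.alphaFun hs hnd cfg) (h.halfConnectionDiff hs hnd cfg) x
                ((h.canonicalSpincStructure hs hnd).frame ((h.canonicalSpincStructure hs hnd).indexAt x) 2 x) -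
              I * connDeriv (h.alphaFun hs hnd cfg) (h.halfConnectionDiff hs hnd cfg) x
                ((h.canonicalSpincStructure hs hnd).frame ((h.canonicalSpincStructure hs hnd).indexAt x) 3 x))) -
          2⁻¹ * h.alphaSq hs hnd cfg x * (h.alphaSq hs hnd cfg x - h.betaSq hs hnd cfg x - Complex.normSq c)) •
        (s.wedge s).castDeg two_add_two_eq_four) = 0 := by
  have hE := h.integral_dbar_sub_del_energy_eq_zero hs hnd hcl (h.contMDiff_alphaFun hs hnd cfg)
    (A := h.halfConnectionDiff hs hnd cfg) (h.smoothAt_halfConnectionDiff hs hnd cfg)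
  have hpt : ∀ x, 2 * Complex.normSq (h.alphaFun hs hnd cfg x) *
      (mextDeriv (h.halfConnectionDiff hs hnd cfg).toMForm x
          ![(h.canonicalSpincStructure hs hnd).frame ((h.canonicalSpincStructure hs hnd).indexAt x) 0 x,
            (h.canonicalSpincStructure hs hnd).frame ((h.canonicalSpincStructure hs hnd).indexAt x) 1 x] +
        mextDeriv (h.halfConnectionDiff hs hnd cfg).toMForm x
          ![(h.canonicalSpincStructure hs hnd).frame ((h.canonicalSpincStructure hs hnd).indexAt x) 2 x,
            (h.canonicalSpincStructure hs hnd).frame ((h.canonicalSpincStructure hs hnd).indexAt x) 3 x]) =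
      2⁻¹ * h.alphaSq hs hnd cfg x * (h.alphaSq hs hnd cfg x - h.betaSq hs hnd cfg x - Complex.normSq c) := by
    intro x
    rw [h.mextDeriv_halfConnectionDiff_frame_sum hs hnd c hsol x, h.normSq_alphaFun hs hnd cfg x]
    ring
  simp only [hpt] at hE
  exact hE

/-- **Hutchings–Taubes (4.18) for the family, gradient form**:
`∫_N (Σ_k|∇'_kα|² - (|∇'₀α+i∇'₁α|² + |∇'₂α+i∇'₃α|²) + ¼|α|²(|α|² - |β|² - r))(s ∧ s) = 0`, i.e.
"`∫|∇_aα|² = ∫ 2|∂̄_aα|² + ∫ r(1 - |α|² + |β|²)|α|²`" in Taubes's scaling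
(`|p+iq|² + |p-iq|² = 2(|p|² + |q|²)`). [cite: HutchingsTaubes2006, §4.5 (4.18)] -/
theorem integral_grad_alpha_energy_eq_zero [T2Space N] [CompactSpace N] [(h.metric hs).HasLeviCivita]
    (hcl : IsClosedForm s) (c : ℂ) {cfg : (h.canonicalSpincStructure hs hnd).Configuration}
    (hsol : SpincStructure.IsSolution (h.taubesPerturbation hs hnd - h.symplecticPerturbation hs hnd (Complex.normSq c / 4)) cfg) :
    MForm.integral (rayFamily (wedge_self_castDeg_apply_ne_zero s hnd))
      ((fun x ↦
          (∑ k, Complex.normSq (connDeriv (h.alphaFun hs hnd cfg) (h.halfConnectionDiff hs hnd cfg) x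
              ((h.canonicalSpincStructure hs hnd).frame ((h.canonicalSpincStructure hs hnd).indexAt x) k x))) -
          (Complex.normSq (connDeriv (h.alphaFun hs hnd cfg) (h.halfConnectionDiff hs hnd cfg) x
                ((h.canonicalSpincStructure hs hnd).frame ((h.canonicalSpincStructure hs hnd).indexAt x) 0 x) +
              I * connDeriv (h.alphaFun hs hnd cfg) (h.halfConnectionDiff hs hnd cfg) x
                ((h.canonicalSpincStructure hs hnd).frame ((h.canonicalSpincStructure hs hnd).indexAt x) 1 x)) +
            Complex.normSq (connDeriv (h.alphaFun hs hnd cfg) (h.halfConnectionDiff hs hnd cfg) x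
                ((h.canonicalSpincStructure hs hnd).frame ((h.canonicalSpincStructure hs hnd).indexAt x) 2 x) +
              I * connDeriv (h.alphaFun hs hnd cfg) (h.halfConnectionDiff hs hnd cfg) x
                ((h.canonicalSpincStructure hs hnd).frame ((h.canonicalSpincStructure hs hnd).indexAt x) 3 x))) +
          4⁻¹ * h.alphaSq hs hnd cfg x * (h.alphaSq hs hnd cfg x - h.betaSq hs hnd cfg x - Complex.normSq c)) •
        (s.wedge s).castDeg two_add_two_eq_four) = 0 := by
  have hE := h.integral_dbar_sub_del_alpha_eq_zero hs hnd hcl c hsol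
  -- `|p+iq|² + |p-iq|² = 2(|p|²+|q|²)`: the gradient form is `-½ ×` the `∂̄`/`∂` form
  have halg : ∀ p q : ℂ, Complex.normSq (p - I * q) = 2 * (Complex.normSq p + Complex.normSq q) - Complex.normSq (p + I * q) := by
    intro p q
    simp only [Complex.normSq_apply, Complex.sub_re, Complex.sub_im, Complex.add_re, Complex.add_im, Complex.mul_re,
      Complex.mul_im, Complex.I_re, Complex.I_im]
    ring
  have hpt : ∀ x,
      (∑ k, Complex.normSq (connDeriv (h.alphaFun hs hnd cfg) (h.halfConnectionDiff hs hnd cfg) x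
          ((h.canonicalSpincStructure hs hnd).frame ((h.canonicalSpincStructure hs hnd).indexAt x) k x))) -
        (Complex.normSq (connDeriv (h.alphaFun hs hnd cfg) (h.halfConnectionDiff hs hnd cfg) x
              ((h.canonicalSpincStructure hs hnd).frame ((h.canonicalSpincStructure hs hnd).indexAt x) 0 x) +
            I * connDeriv (h.alphaFun hs hnd cfg) (h.halfConnectionDiff hs hnd cfg) x
              ((h.canonicalSpincStructure hs hnd).frame ((h.canonicalSpincStructure hs hnd).indexAt x) 1 x)) +
          Complex.normSq (connDeriv (h.alphaFun hs hnd cfg) (h.halfConnectionDiff hs hnd cfg) x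
              ((h.canonicalSpincStructure hs hnd).frame ((h.canonicalSpincStructure hs hnd).indexAt x) 2 x) +
            I * connDeriv (h.alphaFun hs hnd cfg) (h.halfConnectionDiff hs hnd cfg) x
              ((h.canonicalSpincStructure hs hnd).frame ((h.canonicalSpincStructure hs hnd).indexAt x) 3 x))) +
        4⁻¹ * h.alphaSq hs hnd cfg x * (h.alphaSq hs hnd cfg x - h.betaSq hs hnd cfg x - Complex.normSq c) =
      (-2⁻¹ : ℝ) * ((Complex.normSq (connDeriv (h.alphaFun hs hnd cfg) (h.halfConnectionDiff hs hnd cfg) x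
                ((h.canonicalSpincStructure hs hnd).frame ((h.canonicalSpincStructure hs hnd).indexAt x) 0 x) +
              I * connDeriv (h.alphaFun hs hnd cfg) (h.halfConnectionDiff hs hnd cfg) x
                ((h.canonicalSpincStructure hs hnd).frame ((h.canonicalSpincStructure hs hnd).indexAt x) 1 x)) +
            Complex.normSq (connDeriv (h.alphaFun hs hnd cfg) (h.halfConnectionDiff hs hnd cfg) x
                ((h.canonicalSpincStructure hs hnd).frame ((h.canonicalSpincStructure hs hnd).indexAt x) 2 x) +
              I * connDeriv (h.alphaFun hs hnd cfg) (h.halfConnectionDiff hs hnd cfg) x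
                ((h.canonicalSpincStructure hs hnd).frame ((h.canonicalSpincStructure hs hnd).indexAt x) 3 x))) -
          (Complex.normSq (connDeriv (h.alphaFun hs hnd cfg) (h.halfConnectionDiff hs hnd cfg) x
                ((h.canonicalSpincStructure hs hnd).frame ((h.canonicalSpincStructure hs hnd).indexAt x) 0 x) -
              I * connDeriv (h.alphaFun hs hnd cfg) (h.halfConnectionDiff hs hnd cfg) x
                ((h.canonicalSpincStructure hs hnd).frame ((h.canonicalSpincStructure hs hnd).indexAt x) 1 x)) +
            Complex.normSq (connDeriv (h.alphaFun hs hnd cfg) (h.halfConnectionDiff hs hnd cfg) x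
                ((h.canonicalSpincStructure hs hnd).frame ((h.canonicalSpincStructure hs hnd).indexAt x) 2 x) -
              I * connDeriv (h.alphaFun hs hnd cfg) (h.halfConnectionDiff hs hnd cfg) x
                ((h.canonicalSpincStructure hs hnd).frame ((h.canonicalSpincStructure hs hnd).indexAt x) 3 x))) -
          2⁻¹ * h.alphaSq hs hnd cfg x * (h.alphaSq hs hnd cfg x - h.betaSq hs hnd cfg x - Complex.normSq c)) := by
    intro x
    have h1 := halg (connDeriv (h.alphaFun hs hnd cfg) (h.halfConnectionDiff hs hnd cfg) x
      ((h.canonicalSpincStructure hs hnd).frame ((h.canonicalSpincStructure hs hnd).indexAt x) 0 x))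
      (connDeriv (h.alphaFun hs hnd cfg) (h.halfConnectionDiff hs hnd cfg) x
      ((h.canonicalSpincStructure hs hnd).frame ((h.canonicalSpincStructure hs hnd).indexAt x) 1 x))
    have h2 := halg (connDeriv (h.alphaFun hs hnd cfg) (h.halfConnectionDiff hs hnd cfg) x
      ((h.canonicalSpincStructure hs hnd).frame ((h.canonicalSpincStructure hs hnd).indexAt x) 2 x))
      (connDeriv (h.alphaFun hs hnd cfg) (h.halfConnectionDiff hs hnd cfg) x
      ((h.canonicalSpincStructure hs hnd).frame ((h.canonicalSpincStructure hs hnd).indexAt x) 3 x))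
    rw [Fin.sum_univ_four]
    linear_combination (-2⁻¹ : ℝ) * h1 + (-2⁻¹ : ℝ) * h2
  have hfun : ((fun x ↦
          (∑ k, Complex.normSq (connDeriv (h.alphaFun hs hnd cfg) (h.halfConnectionDiff hs hnd cfg) x
              ((h.canonicalSpincStructure hs hnd).frame ((h.canonicalSpincStructure hs hnd).indexAt x) k x))) -
          (Complex.normSq (connDeriv (h.alphaFun hs hnd cfg) (h.halfConnectionDiff hs hnd cfg) x
                ((h.canonicalSpincStructure hs hnd).frame ((h.canonicalSpincStructure hs hnd).indexAt x) 0 x) +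
              I * connDeriv (h.alphaFun hs hnd cfg) (h.halfConnectionDiff hs hnd cfg) x
                ((h.canonicalSpincStructure hs hnd).frame ((h.canonicalSpincStructure hs hnd).indexAt x) 1 x)) +
            Complex.normSq (connDeriv (h.alphaFun hs hnd cfg) (h.halfConnectionDiff hs hnd cfg) x
                ((h.canonicalSpincStructure hs hnd).frame ((h.canonicalSpincStructure hs hnd).indexAt x) 2 x) +
              I * connDeriv (h.alphaFun hs hnd cfg) (h.halfConnectionDiff hs hnd cfg) x
                ((h.canonicalSpincStructure hs hnd).frame ((h.canonicalSpincStructure hs hnd).indexAt x) 3 x))) +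
          4⁻¹ * h.alphaSq hs hnd cfg x * (h.alphaSq hs hnd cfg x - h.betaSq hs hnd cfg x - Complex.normSq c)) •
        (s.wedge s).castDeg two_add_two_eq_four : MForm (𝓡 4) N ℝ 4) =
      (-2⁻¹ : ℝ) • ((fun x ↦
          (Complex.normSq (connDeriv (h.alphaFun hs hnd cfg) (h.halfConnectionDiff hs hnd cfg) x
                ((h.canonicalSpincStructure hs hnd).frame ((h.canonicalSpincStructure hs hnd).indexAt x) 0 x) +
              I * connDeriv (h.alphaFun hs hnd cfg) (h.halfConnectionDiff hs hnd cfg) x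
                ((h.canonicalSpincStructure hs hnd).frame ((h.canonicalSpincStructure hs hnd).indexAt x) 1 x)) +
            Complex.normSq (connDeriv (h.alphaFun hs hnd cfg) (h.halfConnectionDiff hs hnd cfg) x
                ((h.canonicalSpincStructure hs hnd).frame ((h.canonicalSpincStructure hs hnd).indexAt x) 2 x) +
              I * connDeriv (h.alphaFun hs hnd cfg) (h.halfConnectionDiff hs hnd cfg) x
                ((h.canonicalSpincStructure hs hnd).frame ((h.canonicalSpincStructure hs hnd).indexAt x) 3 x))) -
          (Complex.normSq (connDeriv (h.alphaFun hs hnd cfg) (h.halfConnectionDiff hs hnd cfg) x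
                ((h.canonicalSpincStructure hs hnd).frame ((h.canonicalSpincStructure hs hnd).indexAt x) 0 x) -
              I * connDeriv (h.alphaFun hs hnd cfg) (h.halfConnectionDiff hs hnd cfg) x
                ((h.canonicalSpincStructure hs hnd).frame ((h.canonicalSpincStructure hs hnd).indexAt x) 1 x)) +
            Complex.normSq (connDeriv (h.alphaFun hs hnd cfg) (h.halfConnectionDiff hs hnd cfg) x
                ((h.canonicalSpincStructure hs hnd).frame ((h.canonicalSpincStructure hs hnd).indexAt x) 2 x) -
              I * connDeriv (h.alphaFun hs hnd cfg) (h.halfConnectionDiff hs hnd cfg) x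
                ((h.canonicalSpincStructure hs hnd).frame ((h.canonicalSpincStructure hs hnd).indexAt x) 3 x))) -
          2⁻¹ * h.alphaSq hs hnd cfg x * (h.alphaSq hs hnd cfg x - h.betaSq hs hnd cfg x - Complex.normSq c)) •
        (s.wedge s).castDeg two_add_two_eq_four) := by
    rw [show (fun x ↦
          (∑ k, Complex.normSq (connDeriv (h.alphaFun hs hnd cfg) (h.halfConnectionDiff hs hnd cfg) x
              ((h.canonicalSpincStructure hs hnd).frame ((h.canonicalSpincStructure hs hnd).indexAt x) k x))) -
          (Complex.normSq (connDeriv (h.alphaFun hs hnd cfg) (h.halfConnectionDiff hs hnd cfg) x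
                ((h.canonicalSpincStructure hs hnd).frame ((h.canonicalSpincStructure hs hnd).indexAt x) 0 x) +
              I * connDeriv (h.alphaFun hs hnd cfg) (h.halfConnectionDiff hs hnd cfg) x
                ((h.canonicalSpincStructure hs hnd).frame ((h.canonicalSpincStructure hs hnd).indexAt x) 1 x)) +
            Complex.normSq (connDeriv (h.alphaFun hs hnd cfg) (h.halfConnectionDiff hs hnd cfg) x
                ((h.canonicalSpincStructure hs hnd).frame ((h.canonicalSpincStructure hs hnd).indexAt x) 2 x) +
              I * connDeriv (h.alphaFun hs hnd cfg) (h.halfConnectionDiff hs hnd cfg) x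
                ((h.canonicalSpincStructure hs hnd).frame ((h.canonicalSpincStructure hs hnd).indexAt x) 3 x))) +
          4⁻¹ * h.alphaSq hs hnd cfg x * (h.alphaSq hs hnd cfg x - h.betaSq hs hnd cfg x - Complex.normSq c)) = _
        from funext hpt]
    funext x
    ext w
    simp [mul_assoc]
  rw [hfun, MForm.integral_smul, hE, mul_zero]

/-! ### The Bogomolny form: "it is auspicious that the square `(1 - |α|²)²` appears" -/

/-- **The gradient-energy integrand is the `ω`-component of `dθ`, `θ = Im(ᾱ∇'α)`**: at every point,
`dθ(e₀,e₁) + dθ(e₂,e₃) = Σ_k|∇'_kα|² - (|∇'₀α+i∇'₁α|² + |∇'₂α+i∇'₃α|²) + ¼|α|²(|α|² - |β|² - r)` for a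
solution of the family. [cite: HutchingsTaubes2006, §4.5 (4.18)] -/
theorem mextDeriv_energyForm_frame_sum_eq [(h.metric hs).HasLeviCivita] (c : ℂ)
    {cfg : (h.canonicalSpincStructure hs hnd).Configuration}
    (hsol : SpincStructure.IsSolution (h.taubesPerturbation hs hnd - h.symplecticPerturbation hs hnd (Complex.normSq c / 4)) cfg)
    (x : N) :
    mextDeriv (energyForm (h.alphaFun hs hnd cfg) (h.halfConnectionDiff hs hnd cfg)).toMForm x ![((h.canonicalSpincStructure hs hnd).frame ((h.canonicalSpincStructure hs hnd).indexAt x) 0 x), ((h.canonicalSpincStructure hs hnd).frame ((h.canonicalSpincStructure hs hnd).indexAt x) 1 x)] +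
      mextDeriv (energyForm (h.alphaFun hs hnd cfg) (h.halfConnectionDiff hs hnd cfg)).toMForm x ![((h.canonicalSpincStructure hs hnd).frame ((h.canonicalSpincStructure hs hnd).indexAt x) 2 x), ((h.canonicalSpincStructure hs hnd).frame ((h.canonicalSpincStructure hs hnd).indexAt x) 3 x)] =
      (∑ k, Complex.normSq (connDeriv (h.alphaFun hs hnd cfg) (h.halfConnectionDiff hs hnd cfg) x
          ((h.canonicalSpincStructure hs hnd).frame ((h.canonicalSpincStructure hs hnd).indexAt x) k x))) -
        (Complex.normSq (connDeriv (h.alphaFun hs hnd cfg) (h.halfConnectionDiff hs hnd cfg) x ((h.canonicalSpincStructure hs hnd).frame ((h.canonicalSpincStructure hs hnd).indexAt x) 0 x) + I * connDeriv (h.alphaFun hs hnd cfg) (h.halfConnectionDiff hs hnd cfg) x ((h.canonicalSpincStructure hs hnd).frame ((h.canonicalSpincStructure hs hnd).indexAt x) 1 x)) + Complex.normSq (connDeriv (h.alphaFun hs hnd cfg) (h.halfConnectionDiff hs hnd cfg) x ((h.canonicalSpincStructure hs hnd).frame ((h.canonicalSpincStructure hs hnd).indexAt x) 2 x) + I * connDeriv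 (h.alphaFun hs hnd cfg) (h.halfConnectionDiff hs hnd cfg) x ((h.canonicalSpincStructure hs hnd).frame ((h.canonicalSpincStructure hs hnd).indexAt x) 3 x))) +
        4⁻¹ * h.alphaSq hs hnd cfg x * (h.alphaSq hs hnd cfg x - h.betaSq hs hnd cfg x - Complex.normSq c) := by
  have hframe : ∀ k : Fin 4, ContMDiffAt (𝓡 4) ((𝓡 4).prod 𝓘(ℝ, EuclideanSpace ℝ (Fin 4))) ∞
      (fun y : N ↦ Bundle.TotalSpace.mk' (EuclideanSpace ℝ (Fin 4)) (E := (TangentSpace (𝓡 4) : N → Type _)) y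
        ((h.canonicalSpincStructure hs hnd).frame ((h.canonicalSpincStructure hs hnd).indexAt x) k y)) x := fun k ↦
    (h.canonicalSpincStructure hs hnd).contMDiffAt_frame _ k ((h.canonicalSpincStructure hs hnd).mem_baseSet_indexAt x)
  have hα := h.contMDiff_alphaFun hs hnd cfg
  have ha := h.smoothAt_halfConnectionDiff hs hnd cfg
  rw [mextDeriv_energyForm_apply hα ha (hframe 0) (hframe 1), mextDeriv_energyForm_apply hα ha (hframe 2) (hframe 3)]
  have hF := h.mextDeriv_halfConnectionDiff_frame_sum hs hnd c hsol x
  have halg : ∀ p q : ℂ, 2 * (conj p * q).im = Complex.normSq p + Complex.normSq q - Complex.normSq (p + I * q) := by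
    intro p q
    simp only [Complex.normSq_apply, Complex.add_re, Complex.add_im, Complex.mul_re, Complex.mul_im, Complex.I_re, Complex.I_im,
      Complex.conj_re, Complex.conj_im]
    ring
  rw [Fin.sum_univ_four, h.normSq_alphaFun hs hnd cfg x]
  linear_combination halg (connDeriv (h.alphaFun hs hnd cfg) (h.halfConnectionDiff hs hnd cfg) x ((h.canonicalSpincStructure hs hnd).frame ((h.canonicalSpincStructure hs hnd).indexAt x) 0 x)) (connDeriv (h.alphaFun hs hnd cfg) (h.halfConnectionDiff hs hnd cfg) x ((h.canonicalSpincStructure hs hnd).frame ((h.canonicalSpincStructure hs hnd).indexAt x) 1 x)) + halg (connDeriv (h.alphaFun hs hnd cfg) (h.halfConnectionDiff hs hnd cfg) x ((h.canonicalSpincStructure hs hnd).frame ((h.canonicalSpincStructure hs hnd).indexAt x) 2 x)) (connDeriv (h.alphaFun hs hnd cfg) (h.halfConnectionDiff hs hnd cfg) x ((h.canonicalSpincStructure hs hnd).frame ((h.canonicalSpincStructure hs hnd).indexAt x) 3 x)) + h.alphaSq hs hnd cfg x * hF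

/-- **The Bogomolny form of the `α`-energy is exact**: for a solution of the family, the top form
`(Σ_k|∇'_kα|² - (|∇'₀α+i∇'₁α|² + |∇'₂α+i∇'₃α|²) + ¼(|α|² - r)² - ¼|β|²(|α|² - r))(s ∧ s)`
is `2 dθ ∧ s - r (F_A - F_{A₀}) ∧ s`, `θ = Im(ᾱ∇'α)` — a sum of exact forms
(`¼|α|²(|α|²-|β|²-r) - ¼r(|α|²-|β|²-r) = ¼(|α|²-r)² - ¼|β|²(|α|²-r)`, and `(F_A - F_{A₀}) ∧ s =
¼(|α|²-|β|²-r)(s∧s)`). [cite: HutchingsTaubes2006, §4.5 (4.18)–(4.19)] -/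
theorem bogomolnyForm_mem_exactSmoothForms [(h.metric hs).HasLeviCivita] (hcl : IsClosedForm s) (c : ℂ)
    {cfg : (h.canonicalSpincStructure hs hnd).Configuration}
    (hsol : SpincStructure.IsSolution (h.taubesPerturbation hs hnd - h.symplecticPerturbation hs hnd (Complex.normSq c / 4)) cfg) :
    ((fun x ↦
        (∑ k, Complex.normSq (connDeriv (h.alphaFun hs hnd cfg) (h.halfConnectionDiff hs hnd cfg) x
            ((h.canonicalSpincStructure hs hnd).frame ((h.canonicalSpincStructure hs hnd).indexAt x) k x))) -
          (Complex.normSq (connDeriv (h.alphaFun hs hnd cfg) (h.halfConnectionDiff hs hnd cfg) x ((h.canonicalSpincStructure hs hnd).frame ((h.canonicalSpincStructure hs hnd).indexAt x) 0 x) + I * connDeriv (h.alphaFun hs hnd cfg) (h.halfConnectionDiff hs hnd cfg) x ((h.canonicalSpincStructure hs hnd).frame ((h.canonicalSpincStructure hs hnd).indexAt x) 1 x)) + Complex.normSq (connDeriv (h.alphaFun hs hnd cfg) (h.halfConnectionDiff hs hnd cfg) x ((h.canonicalSpincStructure hs hnd).frame ((h.canonicalSpincStructure hs hnd).indexAt x)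 2 x) + I * connDeriv (h.alphaFun hs hnd cfg) (h.halfConnectionDiff hs hnd cfg) x ((h.canonicalSpincStructure hs hnd).frame ((h.canonicalSpincStructure hs hnd).indexAt x) 3 x))) +
          4⁻¹ * (h.alphaSq hs hnd cfg x - Complex.normSq c) ^ 2 -
          4⁻¹ * h.betaSq hs hnd cfg x * (h.alphaSq hs hnd cfg x - Complex.normSq c)) •
      (s.wedge s).castDeg two_add_two_eq_four) ∈ exactSmoothForms (𝓡 4) N ℝ 4 := by
  -- the two exact forms
  have hθ : IsSmoothForm (energyForm (h.alphaFun hs hnd cfg) (h.halfConnectionDiff hs hnd cfg)).toMForm := fun x ↦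
    smoothAt_energyForm (h.contMDiff_alphaFun hs hnd cfg) (h.smoothAt_halfConnectionDiff hs hnd cfg) x
  have hex₁ := mextDeriv_toMForm_wedge_mem_exactSmoothForms hs hcl hθ
  have hex₂ := h.wedge_curvatureForm_sub_mem_exactSmoothForms hs hnd hcl cfg.conn (h.taubesConnection hs hnd)
  -- both are function multiples of `s ∧ s`
  have hw₁ := h.wedge_symplectic_eq_smul_wedge_self hs hnd
    (mextDeriv (energyForm (h.alphaFun hs hnd cfg) (h.halfConnectionDiff hs hnd cfg)).toMForm)
  have hw₂ := h.wedge_symplectic_eq_smul_wedge_self hs hnd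
    ((h.canonicalSpincStructure hs hnd).curvatureForm cfg.conn - (h.canonicalSpincStructure hs hnd).curvatureForm (h.taubesConnection hs hnd))
  have hfun₁ : (fun x ↦ (mextDeriv (energyForm (h.alphaFun hs hnd cfg) (h.halfConnectionDiff hs hnd cfg)).toMForm x
        ![(h.canonicalSpincStructure hs hnd).frame ((h.canonicalSpincStructure hs hnd).indexAt x) 0 x, (h.canonicalSpincStructure hs hnd).frame ((h.canonicalSpincStructure hs hnd).indexAt x) 1 x] +
      mextDeriv (energyForm (h.alphaFun hs hnd cfg) (h.halfConnectionDiff hs hnd cfg)).toMForm x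
        ![(h.canonicalSpincStructure hs hnd).frame ((h.canonicalSpincStructure hs hnd).indexAt x) 2 x, (h.canonicalSpincStructure hs hnd).frame ((h.canonicalSpincStructure hs hnd).indexAt x) 3 x]) / 2) =
      fun x ↦ ((∑ k, Complex.normSq (connDeriv (h.alphaFun hs hnd cfg) (h.halfConnectionDiff hs hnd cfg) x
          ((h.canonicalSpincStructure hs hnd).frame ((h.canonicalSpincStructure hs hnd).indexAt x) k x))) -
        (Complex.normSq (connDeriv (h.alphaFun hs hnd cfg) (h.halfConnectionDiff hs hnd cfg) x ((h.canonicalSpincStructure hs hnd).frame ((h.canonicalSpincStructure hs hnd).indexAt x) 0 x) +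
            I * connDeriv (h.alphaFun hs hnd cfg) (h.halfConnectionDiff hs hnd cfg) x ((h.canonicalSpincStructure hs hnd).frame ((h.canonicalSpincStructure hs hnd).indexAt x) 1 x)) +
          Complex.normSq (connDeriv (h.alphaFun hs hnd cfg) (h.halfConnectionDiff hs hnd cfg) x ((h.canonicalSpincStructure hs hnd).frame ((h.canonicalSpincStructure hs hnd).indexAt x) 2 x) +
            I * connDeriv (h.alphaFun hs hnd cfg) (h.halfConnectionDiff hs hnd cfg) x ((h.canonicalSpincStructure hs hnd).frame ((h.canonicalSpincStructure hs hnd).indexAt x) 3 x))) +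
        4⁻¹ * h.alphaSq hs hnd cfg x * (h.alphaSq hs hnd cfg x - h.betaSq hs hnd cfg x - Complex.normSq c)) / 2 := by
    funext x
    rw [h.mextDeriv_energyForm_frame_sum_eq hs hnd c hsol x]
  have hfun₂ : (fun x ↦ (((h.canonicalSpincStructure hs hnd).curvatureForm cfg.conn - (h.canonicalSpincStructure hs hnd).curvatureForm (h.taubesConnection hs hnd)) x
        ![(h.canonicalSpincStructure hs hnd).frame ((h.canonicalSpincStructure hs hnd).indexAt x) 0 x, (h.canonicalSpincStructure hs hnd).frame ((h.canonicalSpincStructure hs hnd).indexAt x) 1 x] +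
      ((h.canonicalSpincStructure hs hnd).curvatureForm cfg.conn - (h.canonicalSpincStructure hs hnd).curvatureForm (h.taubesConnection hs hnd)) x
        ![(h.canonicalSpincStructure hs hnd).frame ((h.canonicalSpincStructure hs hnd).indexAt x) 2 x, (h.canonicalSpincStructure hs hnd).frame ((h.canonicalSpincStructure hs hnd).indexAt x) 3 x]) / 2) =
      fun x ↦ (h.alphaSq hs hnd cfg x - h.betaSq hs hnd cfg x - Complex.normSq c) / 2 / 2 := by
    funext x
    rw [h.curvatureForm_sub_frame_sum_eq hs hnd c hsol x]
    rfl
  rw [hw₁, hfun₁] at hex₁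
  rw [hw₂, hfun₂] at hex₂
  -- the target is `2 •` the first `- r •` the second
  have hsum := (exactSmoothForms (𝓡 4) N ℝ 4).sub_mem ((exactSmoothForms (𝓡 4) N ℝ 4).smul_mem (2 : ℝ) hex₁)
    ((exactSmoothForms (𝓡 4) N ℝ 4).smul_mem (Complex.normSq c) hex₂)
  convert hsum using 1
  funext x
  ext w
  simp [mul_assoc]
  ring

/-- **Hutchings–Taubes's "auspicious square" identity for the family**: for a solution `(A, ψ)` of
`(SW)` with perturbation `P₊F_{A₀} - (r/4)s`,
`∫_N (Σ_k|∇'_kα|² - (|∇'₀α+i∇'₁α|² + |∇'₂α+i∇'₃α|²) + ¼(|α|² - r)² - ¼|β|²(|α|² - r))(s ∧ s) = 0` —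
"`∫|∇_aα|² = 2π[ω]·e + ∫(2|∂̄_aα|² + r(1-|α|²+|β|²)(|α|²-1))`" with `e = 0`, in the tree's scaling.
[cite: HutchingsTaubes2006, §4.5 (4.18)–(4.19)] [cite: Taubes1995, §5 Step 3 (5.5)] -/
theorem integral_bogomolny_alpha_eq_zero [T2Space N] [CompactSpace N] [(h.metric hs).HasLeviCivita]
    (hcl : IsClosedForm s) (c : ℂ) {cfg : (h.canonicalSpincStructure hs hnd).Configuration}
    (hsol : SpincStructure.IsSolution (h.taubesPerturbation hs hnd - h.symplecticPerturbation hs hnd (Complex.normSq c / 4)) cfg) :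
    MForm.integral (rayFamily (wedge_self_castDeg_apply_ne_zero s hnd))
      ((fun x ↦
        (∑ k, Complex.normSq (connDeriv (h.alphaFun hs hnd cfg) (h.halfConnectionDiff hs hnd cfg) x
            ((h.canonicalSpincStructure hs hnd).frame ((h.canonicalSpincStructure hs hnd).indexAt x) k x))) -
          (Complex.normSq (connDeriv (h.alphaFun hs hnd cfg) (h.halfConnectionDiff hs hnd cfg) x ((h.canonicalSpincStructure hs hnd).frame ((h.canonicalSpincStructure hs hnd).indexAt x) 0 x) +
              I * connDeriv (h.alphaFun hs hnd cfg) (h.halfConnectionDiff hs hnd cfg) x ((h.canonicalSpincStructure hs hnd).frame ((h.canonicalSpincStructure hs hnd).indexAt x) 1 x)) +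
            Complex.normSq (connDeriv (h.alphaFun hs hnd cfg) (h.halfConnectionDiff hs hnd cfg) x ((h.canonicalSpincStructure hs hnd).frame ((h.canonicalSpincStructure hs hnd).indexAt x) 2 x) +
              I * connDeriv (h.alphaFun hs hnd cfg) (h.halfConnectionDiff hs hnd cfg) x ((h.canonicalSpincStructure hs hnd).frame ((h.canonicalSpincStructure hs hnd).indexAt x) 3 x))) +
          4⁻¹ * (h.alphaSq hs hnd cfg x - Complex.normSq c) ^ 2 -
          4⁻¹ * h.betaSq hs hnd cfg x * (h.alphaSq hs hnd cfg x - Complex.normSq c)) •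
      (s.wedge s).castDeg two_add_two_eq_four) = 0 :=
  MForm.integral_eq_zero_of_mem_exactSmoothForms_holds _
    (isContinuousOrientation_rayFamily (wedge_self_castDeg_mem_closedSmoothForms ⟨hs, hcl⟩).1 _)
    (h.bogomolnyForm_mem_exactSmoothForms hs hnd hcl c hsol)

end AlmostComplexStructure.IsCompatibleWith

end Literature.Geometry.Symplectic

end
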